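import Summits.Ventures.CertifiedManyBodySolver.Observables.KKTBlindness
import HarnessLib

/-!
# KKT-blindness, part 2: which pair-word torque rows an invariant pseudo-state passes
# (hubbard-cq census (38)(c), negation-1 SIZING v3 §15(b) — lattice bookkeeping)

HONEST FRAMING: first certified bounds; not a superconductivity verdict. Certificate-GRAMMAR bookkeeping; nothing
here is a number of record, an order parameter or a phase word.

Sibling of `Observables/KKTBlindness.lean` (critic-1 g2's matrix-level kit: an invariant pseudo-state sees the source
ONLY through TORQUE rows `ω([Δ_d†, C])`). This file is the kernel-checked kit of **hubbard-cq-lens-negation-1 g3 (author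
of the sketch `HOME/lean/PairWordRow.negation1.lean`, sha16 1d38980339921c1f; memo NEGATION-SIZING-v3.md ed50981b83af9f8b
§15)**, landed verbatim (declaration names unchanged) by hubbard-cq-p6 on the lead's ACKS 35 (2026-08-27T00:38Z: «one tree
home for the blindness algebra»). CONTENT: for a `U(1)`-invariant, translation-invariant, `S^z`-symmetric pseudo-state with
one-body data `G r = ω(c†_{0σ} c_{rσ})` (`G 0 = n/2`), the operator identity
`[c†_{p↓}c†_{q↑}, c_{x↑}c_{y↓}] = −δ_{py}δ_{qx} + δ_{py} c†_{q↑}c_{x↑} + δ_{qx} c†_{p↓}c_{y↓}` (verified exactly on the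
8-mode Fock space by negation-1's `calc/plaquette.py`; NOT re-derived here) gives, for the `d`-wave source
`Δ_d = √2 Σ_b f_b s_b`, the charged first-order (torque) row of the pair word `X_r = c_{x↑}c_{x+r,↓}`:
`Re ω([Δ_d†, X_r]) = √2 · (2·(D_f G)(r) − f_r)`, `(D_f G)(r) = Σ_{e ∈ {±x̂,±ŷ}} f_e G(r+e)`. This file is ONLY the
lattice bookkeeping after that identity — which separations are BLIND: on-site and diagonal words (`pairWordRow_onsite`,
`pairWordRow_diag`: row ≡ 0 by `C₄`/reflection), the bond words (`pairWordRow_xbond/_ybond`: the ONE scalar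
`√2(2·D_occ − 1)` of job K's `|x − y|² ≤ 2` list, `D_occ = n/2 + G(2,0) − 2G(1,1)`, met identically by particle–hole-type
half-filled data, `pairWordRow_xbond_halfFilled`), versus the first NON-blind word at straight separation 2
(`pairWordRow_two`, `…_eq_zero_iff`: `G(1,0) + G(3,0) = 2G(2,1)` — the K1a⁺/KZa⁺ row of the Edison census), the knight
word, and the flat atomic-limit data `flatG`, blind to EVERY pair word (`pairWordRow_flat`, v3 §15(d)). Census (38) job K
context and numbers: see `KKTBlindness.lean`. Zero compute; no `sorry`; defs `fform`, `dLap`, `pairWordRow`, `dOcc`,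
`flatG`, `IsSymm` are concrete lattice bookkeeping (no junk values).
-/

noncomputable section

namespace Summit.Ventures.CertifiedManyBodySolver.Observables

namespace KKTBlindness

/-- d-wave bond form factor on `ℤ²`: `+1` on `±x̂`, `−1` on `±ŷ`, `0` elsewhere. -/
def fform (r : ℤ × ℤ) : ℝ :=
  if r = (1, 0) ∨ r = (-1, 0) then 1 else if r = (0, 1) ∨ r = (0, -1) then -1 else 0

/-- d-wave Laplacian of one-body data at separation `r`: `Σ_e f_e G(r+e)`. -/
def dLap (G : ℤ × ℤ → ℝ) (r : ℤ × ℤ) : ℝ :=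
  G (r + (1, 0)) + G (r + (-1, 0)) - G (r + (0, 1)) - G (r + (0, -1))

/-- The charged first-order KKT row of the pair word at separation `r` (v3 §15(b)). -/
def pairWordRow (G : ℤ × ℤ → ℝ) (r : ℤ × ℤ) : ℝ :=
  Real.sqrt 2 * (2 * dLap G r - fform r)

/-- d-wave-weighted filling per spin, position-space form: `n/2 + G(2,0) − 2 G(1,1)`. -/
def dOcc (n : ℝ) (G : ℤ × ℤ → ℝ) : ℝ := n / 2 + G (2, 0) - 2 * G (1, 1)

/-- The flat (atomic-limit) half-filled one-body data: `G` supported at the origin. -/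
def flatG : ℤ × ℤ → ℝ := fun s => if s = (0, 0) then 1 / 2 else 0

/-- Square-lattice point-group symmetry of the one-body data (C4 and reflections). -/
structure IsSymm (G : ℤ × ℤ → ℝ) : Prop where
  swap : ∀ a b : ℤ, G (b, a) = G (a, b)
  negl : ∀ a b : ℤ, G (-a, b) = G (a, b)
  negr : ∀ a b : ℤ, G (a, -b) = G (a, b)

variable {G : ℤ × ℤ → ℝ} {n : ℝ}

/-- `f(0,0) = 0`. -/
lemma ff00 : fform (0, 0) = 0 := by simp [fform]
/-- `f(1,1) = 0`. -/
lemma ff11 : fform (1, 1) = 0 := by simp [fform]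
/-- `f(1,0) = 1`. -/
lemma ff10 : fform (1, 0) = 1 := by simp [fform]
/-- `f(0,1) = −1`. -/
lemma ff01 : fform (0, 1) = -1 := by simp [fform]
/-- `f(2,0) = 0`. -/
lemma ff20 : fform (2, 0) = 0 := by simp [fform]
/-- `f(2,1) = 0`. -/
lemma ff21 : fform (2, 1) = 0 := by simp [fform]

/-- `(D_f G)(0,0)` unfolded. -/
lemma dLap00 : dLap G (0, 0) = G (1, 0) + G (-1, 0) - G (0, 1) - G (0, -1) := by simp [dLap]
/-- `(D_f G)(1,1)` unfolded. -/
lemma dLap11 : dLap G (1, 1) = G (2, 1) + G (0, 1) - G (1, 2) - G (1, 0) := by norm_num [dLap]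
/-- `(D_f G)(1,0)` unfolded. -/
lemma dLap10 : dLap G (1, 0) = G (2, 0) + G (0, 0) - G (1, 1) - G (1, -1) := by norm_num [dLap]
/-- `(D_f G)(0,1)` unfolded. -/
lemma dLap01 : dLap G (0, 1) = G (1, 1) + G (-1, 1) - G (0, 2) - G (0, 0) := by norm_num [dLap]
/-- `(D_f G)(2,0)` unfolded. -/
lemma dLap20 : dLap G (2, 0) = G (3, 0) + G (1, 0) - G (2, 1) - G (2, -1) := by norm_num [dLap]
/-- `(D_f G)(2,1)` unfolded. -/
lemma dLap21 : dLap G (2, 1) = G (3, 1) + G (1, 1) - G (2, 2) - G (2, 0) := by norm_num [dLap]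

/-- On-site pair word: blind (row ≡ 0) by C4. -/
theorem pairWordRow_onsite (hG : IsSymm G) : pairWordRow G (0, 0) = 0 := by
  rw [pairWordRow, dLap00, ff00, hG.negl 1 0, hG.negr 0 1, hG.swap 1 0]; ring

/-- Diagonal (next-nearest) pair word: blind by C4/reflection. -/
theorem pairWordRow_diag (hG : IsSymm G) : pairWordRow G (1, 1) = 0 := by
  rw [pairWordRow, dLap11, ff11, hG.swap 2 1, hG.swap 1 0]; ring

/-- x-bond pair word: the row is `√2 (2 D_occ − 1)` — the ONE scalar of job K's list. -/
theorem pairWordRow_xbond (hG : IsSymm G) (hG0 : G (0, 0) = n / 2) :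
    pairWordRow G (1, 0) = Real.sqrt 2 * (2 * dOcc n G - 1) := by
  rw [pairWordRow, dLap10, ff10, hG.negr 1 1, hG0, dOcc]; ring

/-- y-bond pair word: minus the x-bond row. -/
theorem pairWordRow_ybond (hG : IsSymm G) (hG0 : G (0, 0) = n / 2) :
    pairWordRow G (0, 1) = -(Real.sqrt 2 * (2 * dOcc n G - 1)) := by
  rw [pairWordRow, dLap01, ff01, hG.negl 1 1, hG.swap 2 0, hG0, dOcc]; ring

/-- Straight separation-2 pair word: NOT blind — the row is `2√2 (G(1,0) + G(3,0) − 2 G(2,1))`. -/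
theorem pairWordRow_two (hG : IsSymm G) :
    pairWordRow G (2, 0) = 2 * Real.sqrt 2 * (G (1, 0) + G (3, 0) - 2 * G (2, 1)) := by
  rw [pairWordRow, dLap20, ff20, hG.negr 2 1]; ring

/-- Knight separation (2,1): row `2√2 (G(3,1) + G(1,1) − G(2,2) − G(2,0))`. -/
theorem pairWordRow_knight : pairWordRow G (2, 1) =
    2 * Real.sqrt 2 * (G (3, 1) + G (1, 1) - G (2, 2) - G (2, 0)) := by
  rw [pairWordRow, dLap21, ff21]; ring

/-- Particle–hole-type half-filled data (`n = 1`, `G(2,0) = G(1,1) = 0`) meets job K's scalar row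
identically: `D_occ = 1/2`, hence the bond rows vanish. -/
theorem dOcc_halfFilled (h20 : G (2, 0) = 0) (h11 : G (1, 1) = 0) : dOcc 1 G = 1 / 2 := by
  rw [dOcc, h20, h11]; ring

/-- Hence the bond rows vanish on particle–hole-type half-filled data. -/
theorem pairWordRow_xbond_halfFilled (hG : IsSymm G) (hG0 : G (0, 0) = 1 / 2)
    (h20 : G (2, 0) = 0) (h11 : G (1, 1) = 0) : pairWordRow G (1, 0) = 0 := by
  rw [pairWordRow_xbond (n := 1) hG (by rw [hG0]), dOcc_halfFilled h20 h11]; ring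

/-- … but the same data is seen by the separation-2 row unless `G(1,0) + G(3,0) = 2 G(2,1)`:
a Mott-type state (`G(1,0) ≈ 0.13`, `G(3,0), G(2,1)` small) violates it. -/
theorem pairWordRow_two_eq_zero_iff (hG : IsSymm G) :
    pairWordRow G (2, 0) = 0 ↔ G (1, 0) + G (3, 0) = 2 * G (2, 1) := by
  rw [pairWordRow_two hG]
  have hs : (2 : ℝ) * Real.sqrt 2 ≠ 0 := by positivity
  constructor
  · intro h
    have := (mul_eq_zero.mp h).resolve_left hs
    linarith
  · intro h
    rw [show G (1, 0) + G (3, 0) - 2 * G (2, 1) = 0 by linarith]; ring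

/-- The flat distribution (`G` supported at the origin, `n = 1`) is blind to EVERY pair word:
the complete pair-word family forces nothing beyond it (v3 §15(d)). -/
theorem pairWordRow_flat (r : ℤ × ℤ) : pairWordRow flatG r = 0 := by
  obtain ⟨a, b⟩ := r
  simp only [pairWordRow, dLap, fform, flatG, Prod.mk_add_mk, Prod.mk.injEq]
  split_ifs <;> (try (exfalso; omega)) <;> norm_num

end KKTBlindness

end Summit.Ventures.CertifiedManyBodySolver.Observables

end
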